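import Mathlib
import Literature.Combinatorics.Enumerative.DerivativePolynomialGeneratingFunctions
import HarnessLib

/-!
# `2ⁿ Dⁿ(tan x + sec x) = Pₙ(tan x + sec x)` (Ma 2013, eqs. (1), (2) and Proposition 1)

[cite: Ma2013TwoVariableDerivativePolynomials, §1 eqs. (1), (2), Proposition 1 (Electron. J. Combin. 20(1) (2013) #P11, p. 2)]

A small complement to `DerivativePolynomialGeneratingFunctions` (Hoffman's `Pₙ`, the closed forms
`P(0,t) = tan t`, `Q(0,t) = sec t`): the Euler-number generating function `S(x) = tan x + sec x` itself is a
fixed argument of the derivative polynomials.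

## Source (verbatim)

«Let S(x) = y + z [y = tan x, z = sec x]. Clearly, S(0) = 1. It is easy to verify that 2D(S(x)) = 1 + S²(x). (1)
Differentiation of (1) gives 2²D²(S(x)) = 2S(x) + 2S³(x). (2)  A second differentiation gives
2³D³(S(x)) = 2 + 8S²(x) + 6S⁴(x). Now we present a connection between S(x) and Pₙ(u).
Proposition 1. For n ≥ 0, we have 2ⁿDⁿ(S(x)) = Pₙ(S(x)).
Proof. We proceed by induction on n. … 2^{k+1}D^{k+1}(S(x)) = 2D(P_k(S(x))) = 2P_k′(S(x))D(S(x))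
= (1 + S²(x))P_k′(S(x)) = P_{k+1}(S(x)).»

## What is typed

Over a field `K ⊇ ℚ`, with `S = P(0,t) + Q(0,t) = tan t + sec t ∈ K⟦t⟧` (`egfP 0 + egfQ 0`): `sec² = 1 + tan²`
(`egfQ_zero_sq`), (1) `two_mul_derivative_tanAddSec`, (2) `four_mul_derivative_two_tanAddSec`, the printed third
derivative, and Proposition 1 `iterate_derivative_tanAddSec` by the printed induction; at `t = 0` it gives back
`Pₙ(1) = 2ⁿEₙ` (Hoffman's (5), the tree's `eval_one_P`).  No new named facts.
-/

namespace Literature.Combinatorics.Enumerative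
namespace DerivativePolynomials

open PowerSeries Finset
open scoped Nat
open Literature.ComputerArithmetic.BrentZimmermann2010

section Field

variable {K : Type*} [Field K] [CharZero K]

/-- **`S(x) = tan x + sec x`**, the exponential generating function of the Euler numbers, as `P(0,t) + Q(0,t)`.
[cite: Ma2013TwoVariableDerivativePolynomials, §1 («Let S(x) = y + z»; «y + z = Σ Eₙ xⁿ/n!»)] -/
noncomputable def tanAddSec (K : Type*) [Field K] : K⟦X⟧ := egfP (0 : K) + egfQ 0

/-- `S(0) = 1`. [cite: Ma2013TwoVariableDerivativePolynomials, §1 («Clearly, S(0) = 1»)] -/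
theorem constantCoeff_tanAddSec : constantCoeff (tanAddSec K) = 1 := by
  rw [tanAddSec, map_add, constantCoeff_egfP, constantCoeff_egfQ, zero_add]

/-- Over `ℚ`: `S = tanSeries + secSeries` (the tree's `tan`, `sec`). [cite: Ma2013TwoVariableDerivativePolynomials, §1 («S(x) = y + z», y = tan x, z = sec x)] -/
theorem tanAddSec_rat : tanAddSec ℚ = tanSeries + secSeries := by
  rw [tanAddSec, egfP_zero, egfQ_zero]

/-- The coefficients of `S` are `Eₙ/n!`. [cite: Ma2013TwoVariableDerivativePolynomials, §1 («y + z = Σ_{n≥0} Eₙ xⁿ/n!»)] -/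
theorem coeff_tanAddSec_rat (n : ℕ) : coeff n (tanAddSec ℚ) = (eulerZigzag n : ℚ) / n ! := by
  rw [tanAddSec, map_add, coeff_egfP, coeff_egfQ, aeval_zero_nat, aeval_zero_nat, Polynomial.coeff_zero_eq_eval_zero,
    Polynomial.coeff_zero_eq_eval_zero, ← add_div, ← Nat.cast_add, eval_zero_P_add_eval_zero_Q]

/-- **The tangent identity `1 + y² = z²`** for the formal series: `Q(0,t)² = 1 + P(0,t)²` (`sec² = 1 + tan²`).
[cite: Ma2013TwoVariableDerivativePolynomials, §1 («An important tangent identity is given by 1 + y² = z²»)] -/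
theorem egfQ_zero_sq : egfQ (0 : K) ^ 2 = 1 + egfP (0 : K) ^ 2 := by
  have hD := den_mul_inv (0 : K)
  have hsc := sin_sq_add_cos_sq_eq (K := K)
  rw [egfQ_eq, egfP_eq]
  simp only [map_zero, zero_mul, sub_zero, add_zero] at hD ⊢
  set c := PowerSeries.cos K
  set s := PowerSeries.sin K
  set X := c⁻¹
  linear_combination (c * X + 1) * hD - X ^ 2 * hsc

/-- ★ **(1)**: `2S′ = 1 + S²`. [cite: Ma2013TwoVariableDerivativePolynomials, §1 eq. (1) («2D(S(x)) = 1 + S²(x)»)] -/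
theorem two_mul_derivative_tanAddSec : 2 * d⁄dX K (tanAddSec K) = 1 + tanAddSec K ^ 2 := by
  rw [tanAddSec, map_add, derivative_egfP, derivative_egfQ]
  linear_combination -egfQ_zero_sq (K := K)

/-- ★ **(2)**: `2²S″ = 2S + 2S³`. [cite: Ma2013TwoVariableDerivativePolynomials, §1 eq. (2) («2²D²(S(x)) = 2S(x) + 2S³(x)»)] -/
theorem four_mul_derivative_two_tanAddSec :
    4 * d⁄dX K (d⁄dX K (tanAddSec K)) = 2 * tanAddSec K + 2 * tanAddSec K ^ 3 := by
  have h1 := two_mul_derivative_tanAddSec (K := K)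
  have h2 : d⁄dX K (2 * d⁄dX K (tanAddSec K)) = d⁄dX K (1 + tanAddSec K ^ 2) := by rw [h1]
  rw [show (2 : K⟦X⟧) = C (2 : K) from (map_ofNat C 2).symm, derivative_C_mul, map_add, Derivation.map_one_eq_zero,
    Derivation.leibniz_pow, map_ofNat] at h2
  simp only [smul_eq_mul, nsmul_eq_mul, Nat.cast_ofNat, zero_add] at h2
  linear_combination 2 * h2 + (2 * tanAddSec K) * h1

/-- «A second differentiation gives `2³D³(S(x)) = 2 + 8S²(x) + 6S⁴(x)`.»
[cite: Ma2013TwoVariableDerivativePolynomials, §1 («A second differentiation gives 2³D³(S(x)) = 2 + 8S²(x) + 6S⁴(x)»)] -/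
theorem eight_mul_derivative_three_tanAddSec :
    8 * d⁄dX K (d⁄dX K (d⁄dX K (tanAddSec K))) = 2 + 8 * tanAddSec K ^ 2 + 6 * tanAddSec K ^ 4 := by
  have h1 := two_mul_derivative_tanAddSec (K := K)
  have h2 := four_mul_derivative_two_tanAddSec (K := K)
  have h3 : d⁄dX K (4 * d⁄dX K (d⁄dX K (tanAddSec K))) = d⁄dX K (2 * tanAddSec K + 2 * tanAddSec K ^ 3) := by
    rw [h2]
  rw [show (4 : K⟦X⟧) = C (4 : K) from (map_ofNat C 4).symm, show (2 : K⟦X⟧) = C (2 : K) from (map_ofNat C 2).symm,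
    derivative_C_mul, map_add, derivative_C_mul, derivative_C_mul, Derivation.leibniz_pow, map_ofNat,
    map_ofNat] at h3
  simp only [smul_eq_mul, nsmul_eq_mul, Nat.cast_ofNat] at h3
  linear_combination 2 * h3 + (2 + 6 * tanAddSec K ^ 2) * h1

/-- ★★ **Proposition 1**: `2ⁿ Dⁿ S = Pₙ(S)` for all `n ≥ 0` — by induction, `2^{k+1}D^{k+1}S = 2D(P_k(S)) =
2P_k′(S)·DS = (1 + S²)P_k′(S) = P_{k+1}(S)`.
[cite: Ma2013TwoVariableDerivativePolynomials, §1 Proposition 1 («For n ≥ 0, we have 2ⁿDⁿ(S(x)) = Pₙ(S(x))»)] -/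
theorem iterate_derivative_tanAddSec : ∀ n : ℕ,
    (2 : K⟦X⟧) ^ n * (⇑(d⁄dX K))^[n] (tanAddSec K) =
      Polynomial.aeval (tanAddSec K) ((TangentNumbers.P n).map (Nat.castRingHom K))
  | 0 => by simp [TangentNumbers.P_zero]
  | n + 1 => by
      have ih := iterate_derivative_tanAddSec n
      have hD : d⁄dX K ((2 : K⟦X⟧) ^ n * (⇑(d⁄dX K))^[n] (tanAddSec K)) =
          d⁄dX K (Polynomial.aeval (tanAddSec K) ((TangentNumbers.P n).map (Nat.castRingHom K))) := by rw [ih]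
      rw [show ((2 : K⟦X⟧) ^ n) = C ((2 : K) ^ n) by rw [map_pow, map_ofNat], derivative_C_mul, Derivation.map_aeval,
        smul_eq_mul] at hD
      rw [Function.iterate_succ_apply', pow_succ, TangentNumbers.P_succ, Polynomial.map_mul, ← Polynomial.derivative_map,
        map_mul, Polynomial.map_add, Polynomial.map_one, Polynomial.map_pow, Polynomial.map_X, map_add, map_one,
        map_pow, Polynomial.aeval_X, ← two_mul_derivative_tanAddSec,
        show ((2 : K⟦X⟧) ^ n) = C ((2 : K) ^ n) by rw [map_pow, map_ofNat]]
      linear_combination (2 : K⟦X⟧) * hD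

/-- At `t = 0`: `2ⁿ·(n-th derivative of S at 0) = 2ⁿEₙ = Pₙ(S(0)) = Pₙ(1)` — Hoffman's equation (5) again.
[cite: Ma2013TwoVariableDerivativePolynomials, §1 Proposition 1 (at x = 0, with S(0) = 1); Hoffman1999DerivativePolynomials, §3 eq. (5)] -/
theorem two_pow_mul_eulerZigzag_eq_eval_one_P (n : ℕ) : 2 ^ n * eulerZigzag n = (TangentNumbers.P n).eval 1 := by
  rw [eval_one_P]

end Field

end DerivativePolynomials
end Literature.Combinatorics.Enumerative
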